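import Summits.ABC.IUTFork.Repair.RHQ3LTailUniformWitness
import Summits.ABC.IUTFork.Repair.RHQ3LTailUniform
import Summits.ABC.IUTFork.Conditional.FreyLegendreP6Engine
import Summits.ABC.IUTFork.Conditional.AbcOfSHwindowFreyRefutationP6Tier2
import Summits.ABC.IUTFork.Conditional.AbcOfSHwindowFreyRefutationPrelims
import Summits.ABC.IUTFork.Cor312GenuineKDeepDatum
import Summits.ABC.ABC.Theorems.IUTThetaPilotThetaPartIIStubThetaData
import Literature.IUT.LogVolume.GenuineTowerLocalTypeThirty
import Literature.NumberTheory.EllipticCurves.PointCountEulerCriterion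
import Mathlib.NumberTheory.LSeries.PrimesInAP
import Mathlib.NumberTheory.Bertrand
import Mathlib.NumberTheory.LegendreSymbol.Basic
import HarnessLib

/-!
# D-0079 RESCUE sub-cell R-H, ROUND 2 Q3 — «NOT UNIFORMLY» IN KERNEL, UNCONDITIONALLY: no single level `l₀` puts every genuine
# [IUTchI] Def. 3.1 datum of level `l ≥ l₀` inside Σ₈ (seat abc-iut-rh2-q3-typ-1 g3; part 2 of 2)

PROOF-ONLY file (D-0012; 0 definitions, 0 `Prop` facts, no instance, no notation). Rung LADDER-ABC:A2.RESCUE.H, director charge (10)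
«type `∃ l₀, ∀ l ≥ l₀, every genuine admissible datum lies in Σ_row` per kept row as kernel targets — prove or refute». For row 8 the
per-CURVE reading is PROVED (`RH.Q3LTailSigma8.lTailSigma8_holds`, p479487: `∀ (F, E) ∃ l₀(E) …`, K/ℚ-Galois data); the UNIFORM reading
(`∃ l₀ ∀ curves`) was so far refuted only MODULO the displayed existence input `HeavyGaloisData` (`RHQ3LTailUniform`, p481222). THIS FILE
removes the input for the reading over ALL genuine data: **`not_exists_uniform_l0_inSigma8`** —
`¬ ∃ l₀, ∀ l ≥ l₀, ∀ (F, E, K, F̄, Pb) (D : InitialThetaData F K F̄ E l Pb), InSigma8 D` — with NO hypothesis.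

THE WITNESS FAMILY (classical arithmetic; every step a named tree theorem). Given `l₀`: a prime `l ≡ 3 (mod 4)`, `l > max(l₀, 160)`
(Dirichlet, Mathlib `Nat.forall_exists_prime_gt_and_modEq`); a prime `r` with `30·l < r ≤ 60·l` (Bertrand, Mathlib
`Nat.exists_prime_lt_and_le_two_mul`); the Frey–Legendre point `λ_r = r⁸/(r⁸+1) ∈ ℚ` of the (trivial) abc triple `r⁸ + 1 = r⁸ + 1`:
* `j(λ_r) = 2⁸(r¹⁶ + r⁸ + 1)³/(r¹⁶(r⁸+1)²)` (`Cor22.jInv_ratPoint_triple`): pole of order `16` at `r`, poles of order `2·v_p(r⁸+1) < 2l` at the odd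
  `p ∣ r⁸+1` (`(60l)⁸ + 1 < 3^l` for `l ≥ 160`), `ord₂ j ≥ 0`; hence `λ_r ∈ U_P`, `AdmitsCore`, **(P2)** and **(P5)** at `l` — part 1,
  `RHQ3LTailUniformWitness` (this seat);
* **(P6)** at `(ratPoint λ_r, l)` by abc-iut-w6-d102's datum-parametric engine `FreyP6Engine.condP6_ratPoint_of_certificate` (p477940): the
  integer model `E₁ = [0, −(c²+ac), 0, ac³, 0]`, `a = r⁸ ≡ 1`, `c = r⁸+1 ≡ 2 (mod 5)` reduces to `[0,4,0,3,0]` mod `5` FOR EVERY `r ≠ 5`,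
  `#Ẽ₁(𝔽₅) = 4`, `a₅ = 2`, and Mazur's Frobenius certificate `X² − 2X + 5 = (X−1)² + 4` is rootless mod `l` iff `−1` is a non-square
  mod `l` iff `l ≡ 3 (mod 4)` (Mathlib `ZMod.exists_sq_eq_neg_one_iff`); multiplicative prime `q = r`, `ord_r Δ(E₁) = 16`, `l ∤ 16` (§2);
* hence a genuine Θ-volume datum `T` at `(ratPoint λ_r, l)` EXISTS — abc-iut-c312-8 / L5-t7's `ThetaPartII.stub_thetaData` ([IUTchIV] Cor. 2.2
  (ii) proof (P7): «there exist data C̲_K, 𝕍̲, ε̲ such that all of the conditions of [IUTchI], Definition 3.1 are satisfied») (§4);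
* and EVERY such datum is OUTSIDE Σ₈ (§3): at the bad place `x₀ ∣ r` of abc-iut-c312-7's `GenuineK.exists_bad_tame_place_of_ord_neg`,
  `ord_v(q_v) = 16·e(v|r)` ([IUTchI] Def. 3.1 (b): semistable, multiplicative at `v`), `e(x₀|r) ∣ 30·l < r` (abc-iut-W-neg-1's
  `ramificationIdx_int_dvd_thirty_mul_ratPoint'`, so `⌊log_r e_w⌋ = 0`), and `4·l·e(v|r)·2 + 2 ≤ (l−3)·16·e(v|r)` for `l ≥ 7`: the heavy
  inequality of this lineage's `not_inSigma8_of_heavy_of_ramIdx_le` (p479646; [IUTchIV] Prop. 1.2: the Θ-side certified value at the top label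
  `l⋆` is `≥ −(⌊log_p e⌋+1)·e` while the q-side demand is `(l⋆²−1)·ord(q)/(2l)`).

READING (numbers, no side). Together with `lTailSigma8_holds` this is the booked word «Q3: YES PER DATUM, NOT UNIFORMLY» with BOTH halves
theorems: every curve is eventually (in `l`) inside Σ₈, but at every level `l ≡ 3 (4)`, `l ≥ 160` some genuine datum (local height `16` at a prime
`r ∈ (30l, 60l]`) is outside — `l₀(E)` is not bounded over curves. The Galois-GUARDED uniform reading `UniformLTailSigma8` (data with `K/ℚ`
Galois only) stays refuted modulo `HeavyGaloisData`: the witness data here have `K = F‡(λ_r)(E[l])`, Galois over `ℚ` in substance, but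
`IsGalois ℚ K` is not derived in the tree (open bookkeeping item, not claimed). Nothing here asserts abc or takes a side on [IUTchIII] Cor. 3.12
or on any author; `InSigma8` is row 8's HYPOTHESIS vocabulary (R-W `RH.InSigmaDatum.InSigma8`), a statement about OUR typed objects; the
existence of Θ-data used is the tree's `stub_thetaData` over the interface inhabitants of Def. 3.1 (d)(e)(f), exactly as in every R-W
refutation of record (`Conditional.not_hSHwBad_frey_holds`). typed ≠ proved; refuted-as-typed ≠ refuted-in-print.
[cite: Mochizuki2012, IUTchI Def. 3.1 (b)(c) pp. 61–62, Ex. 3.2 (iv) p. 71; IUTchIV Prop. 1.2 (i)(ii) p. 10, Thm. 1.10 Steps (ii)–(iii)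
pp. 24–26, Cor. 2.2 (ii) proof (P2)(P5)(P6)(P7) pp. 45–46] [cite: Mazur1978, §6 Prop. 6.3 (1) p. 153] [cite: MochizukiGenEll2010, Lem. 3.1
(iii) p. 14, Def. 3.3 p. 12] [cite: SilvermanAEC2009, III.1 Prop. 1.7(b), VII.5 Prop. 5.1(b)] [cite: SerreLocalFields1979, Ch. IV §2 Cor. 1 of Prop. 7]
[claim: Mochizuki2012, status: disputed] for every IUT locution.
-/

noncomputable section

open Set Function NumberField IsDedekindDomain

namespace Summit.ABC.IUTFork.Repair.RH.Q3LTailSigma8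

open Literature.IUT.LogThetaLattice Literature.IUT.LogVolume Literature.IUT.HodgeTheaters
open Literature.IUT.LogVolume.ThetaData Literature.IUT.LogVolume.Cor22
open Summit.ABC.IUTFork.Thm311 Summit.ABC.IUTFork.Thm311.Real Summit.ABC.IUTFork.Cor312Prov
open Literature.NumberTheory.NumberFields Literature.NumberTheory.DiophantineGeometry
  Literature.NumberTheory.DiophantineGeometry.GenEll Literature.NumberTheory.DiophantineGeometry.UniformABCConjecture
  Rat.HeightOneSpectrum Summit.ABC.ABC.Theorems Summit.ABC.IUTFork.Conditional

namespace UniformWitness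

/-! ## §2. (P6) at `(ratPoint λ_r, l)` for `l ≡ 3 (mod 4)`: the Frobenius certificate at `5` and the multiplicative prime `r` -/

section P6

open Literature.NumberTheory.EllipticCurves

variable (r : ℕ)

/-- `x⁸ = 1` for every nonzero `x ∈ 𝔽₅` (Fermat), at `x = r mod 5`. [folklore] -/
theorem zmod_five_pow_eight {r : ℕ} (hr5 : ¬ 5 ∣ r) : (r : ZMod 5) ^ 8 = 1 := by
  have hr0 : (r : ZMod 5) ≠ 0 := fun h => hr5 ((ZMod.natCast_eq_zero_iff r 5).1 h)
  have key : ∀ x : ZMod 5, x ≠ 0 → x ^ 8 = 1 := by decide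
  exact key _ hr0

/-- `E₁ mod 5 = [0, 4, 0, 3, 0]` for EVERY `r` prime to `5` (`a = r⁸ ≡ 1`, `c = r⁸ + 1 ≡ 2 (mod 5)` by Fermat). [folklore] -/
theorem model_map_five (hr5 : ¬ 5 ∣ r) :
    (⟨0, -(((r ^ 8 + 1 : ℕ) : ℤ) ^ 2 + (r ^ 8 : ℕ) * (r ^ 8 + 1 : ℕ)), 0, ((r ^ 8 : ℕ) : ℤ) * ((r ^ 8 + 1 : ℕ) : ℤ) ^ 3, 0⟩ :
      WeierstrassCurve ℤ).map (Int.castRingHom (ZMod 5)) = ⟨0, 4, 0, 3, 0⟩ := by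
  have h8 := zmod_five_pow_eight hr5
  ext
  · simp
  · simp only [WeierstrassCurve.map_a₂, Int.coe_castRingHom]; push_cast; rw [h8]; decide
  · simp
  · simp only [WeierstrassCurve.map_a₄, Int.coe_castRingHom]; push_cast; rw [h8]; decide
  · simp

/-- `#Ẽ(𝔽₅) = 4` for `Ẽ = [0, 4, 0, 3, 0]`, i.e. `y² = x(x+1)(x+3)` (kernel count, Euler's criterion). [folklore] -/
theorem natCard_point_five : Nat.card (⟨0, 4, 0, 3, 0⟩ : WeierstrassCurve (ZMod 5)).toAffine.Point = 4 := by
  rw [@WeierstrassCurve.natCard_point_eq_one_add_card (ZMod 5) (@ZMod.instField 5 ⟨by norm_num⟩) _ _ _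
    (by decide +kernel), @card_sol_eq_sum_euler (ZMod 5) (@ZMod.instField 5 ⟨by norm_num⟩) _ _
    (by rw [ZMod.ringChar_zmod_n]; decide)]
  decide +kernel

/-- **`a₅(E₁) = 5 + 1 − 4 = 2`** for every `r` prime to `5`. [cite: SilvermanAEC2009, V.2] -/
theorem frobeniusTrace_five (hr5 : ¬ 5 ∣ r) :
    Literature.NumberTheory.Automorphic.frobeniusTrace (⟨0, -(((r ^ 8 + 1 : ℕ) : ℤ) ^ 2 + (r ^ 8 : ℕ) * (r ^ 8 + 1 : ℕ)), 0,
      ((r ^ 8 : ℕ) : ℤ) * ((r ^ 8 + 1 : ℕ) : ℤ) ^ 3, 0⟩ : WeierstrassCurve ℤ) 5 = 2 := by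
  rw [Literature.NumberTheory.Automorphic.frobeniusTrace, Literature.NumberTheory.Automorphic.numPointsMod, model_map_five r hr5,
    natCard_point_five]; norm_num

/-- **Mazur's Frobenius certificate at `5`**: `X² − 2X + 5 = (X − 1)² + 4` has no root mod a prime `l ≡ 3 (mod 4)` (`−1` is not a square).
[cite: Mazur1978, §6 Prop. 6.3 (1) p. 153] -/
theorem noroot_of_mod_four {l : ℕ} (hl : l.Prime) (hmod : l % 4 = 3) (t : ZMod l) : t ^ 2 - 2 * t + 5 ≠ 0 := by
  haveI : Fact l.Prime := ⟨hl⟩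
  intro h
  have hl2 : l ≠ 2 := by intro h2; rw [h2] at hmod; norm_num at hmod
  have h2 : (2 : ZMod l) ≠ 0 := by
    intro h0
    have : ((2 : ℕ) : ZMod l) = 0 := by exact_mod_cast h0
    rw [ZMod.natCast_eq_zero_iff] at this
    exact hl2 ((Nat.prime_dvd_prime_iff_eq hl Nat.prime_two).1 this)
  have hsq : (t - 1) ^ 2 = -4 := by linear_combination h
  have hI : IsSquare (-1 : ZMod l) := by
    refine ⟨(t - 1) * (2 : ZMod l)⁻¹, ?_⟩
    calc (-1 : ZMod l) = -(2 * (2 : ZMod l)⁻¹) ^ 2 := by rw [mul_inv_cancel₀ h2]; ring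
      _ = -4 * ((2 : ZMod l)⁻¹) ^ 2 := by ring
      _ = (t - 1) ^ 2 * ((2 : ZMod l)⁻¹) ^ 2 := by rw [hsq]
      _ = (t - 1) * (2 : ZMod l)⁻¹ * ((t - 1) * (2 : ZMod l)⁻¹) := by ring
  exact (ZMod.exists_sq_eq_neg_one_iff.1 hI) hmod

/-- `(16 : ZMod r) ≠ 0` for an odd prime `r`. [folklore] -/
theorem sixteen_ne_zero (hr : r.Prime) (hr2 : r ≠ 2) : (16 : ZMod r) ≠ 0 := by
  haveI : NeZero r := ⟨hr.ne_zero⟩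
  intro h
  have h16 : ((16 : ℕ) : ZMod r) = 0 := by exact_mod_cast h
  rw [ZMod.natCast_eq_zero_iff, show (16 : ℕ) = 2 ^ 4 by norm_num] at h16
  exact hr2 ((Nat.prime_dvd_prime_iff_eq hr Nat.prime_two).1 (Nat.Prime.dvd_of_dvd_pow hr h16))

/-- `5 ∤ Δ(E₁) = 16·a²·c⁸·(c−a)²` (`a = r⁸ ≡ 1`, `c ≡ 2`, `c − a = 1`: `Δ ≡ 16·2⁸ ≡ 1 (mod 5)`). [folklore] -/
theorem five_not_dvd_disc (hr5 : ¬ 5 ∣ r) :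
    ¬ ((5 : ℕ) : ℤ) ∣ 16 * ((r ^ 8 : ℕ) : ℤ) ^ 2 * ((r ^ 8 + 1 : ℕ) : ℤ) ^ 8 * (((r ^ 8 + 1 : ℕ) : ℤ) - (r ^ 8 : ℕ)) ^ 2 := by
  have h8 := zmod_five_pow_eight hr5
  intro h
  have h0 := (ZMod.intCast_zmod_eq_zero_iff_dvd _ 5).2 h
  push_cast at h0
  rw [h8] at h0
  exact absurd h0 (by decide)

/-- **(P6) at `(ratPoint λ_r, l)`** for primes `r ∉ {2, 5, l}`, `l ≥ 17`, `l ≡ 3 (mod 4)` — the engine `FreyP6Engine.condP6_ratPoint_of_certificate`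
(p477940) with the good prime `5` (`a₅ = 2`, certificate rootless by `l ≡ 3 (4)`) and the multiplicative prime `q = r` (`r ∤ c₄ ≡ 16`,
`Δ(E₁) = r¹⁶·16(r⁸+1)⁸`, `l ∤ 16`). [cite: Mochizuki2012, IUTchIV Cor. 2.2 (ii) proof (P6) p. 46] [cite: Mazur1978, §6 Prop. 6.3 (1) p. 153]
[cite: MochizukiGenEll2010, Lem. 3.1 (iii) p. 14] [claim: Mochizuki2012, status: disputed] -/
theorem condP6 (hr : r.Prime) (hr2 : r ≠ 2) (hr5 : r ≠ 5) {l : ℕ} (hl : l.Prime) (hl17 : 17 ≤ l) (hmod : l % 4 = 3) (hrl : r ≠ l) :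
    CondP6 (ratPoint (((r ^ 8 : ℕ) : ℚ) / ((r ^ 8 + 1 : ℕ) : ℚ))) l := by
  haveI : Fact l.Prime := ⟨hl⟩
  haveI : Fact (Nat.Prime 5) := ⟨by norm_num⟩
  haveI : NeZero r := ⟨hr.ne_zero⟩
  have hr5' : ¬ 5 ∣ r := fun h => hr5 ((Nat.prime_dvd_prime_iff_eq (by norm_num) hr).1 h).symm
  have hrr : (r : ZMod r) ^ 8 = 0 := by rw [ZMod.natCast_self]; simp
  refine FreyP6Engine.condP6_ratPoint_of_certificate (r ^ 8) (r ^ 8 + 1) (pow_ne_zero _ hr.ne_zero) (Nat.succ_ne_zero _)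
    (Nat.lt_succ_self _).ne l
    (FreyRef.not_dvd_46080_of_seven_le hl (by omega)) 5 (by omega) ?_ ?_ r hr ?_ ?_ 16 (by norm_num) ?_ (16 * ((r ^ 8 + 1 : ℕ) : ℤ) ^ 8) ?_ ?_
  · -- `5 ∤ Δ(E₁)`: `Δ ≡ 16·1·2⁸·1 ≡ 1 (mod 5)`
    rw [FreyP6Engine.Δ_model]
    exact five_not_dvd_disc r hr5'
  · -- the certificate
    intro t
    rw [frobeniusTrace_five r hr5']
    push_cast
    exact noroot_of_mod_four hl hmod t
  · -- `r ∤ l`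
    exact fun h => hrl ((Nat.prime_dvd_prime_iff_eq hr hl).1 h)
  · -- `r ∤ c₄(E₁) ≡ 16 (mod r)`
    rw [FreyP6Engine.c₄_model]
    intro h
    have h0 := (ZMod.intCast_zmod_eq_zero_iff_dvd _ r).2 h
    push_cast at h0
    rw [hrr] at h0
    simp only [zero_add, one_pow, mul_one, sub_zero, add_zero, ne_eq, OfNat.ofNat_ne_zero, not_false_eq_true, zero_pow] at h0
    exact sixteen_ne_zero r hr hr2 h0
  · -- `l ∤ 16`
    intro h; have := Nat.le_of_dvd (by norm_num) h; omega
  · -- `Δ(E₁) = r¹⁶ · 16(r⁸+1)⁸`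
    rw [FreyP6Engine.Δ_model]; push_cast; ring
  · -- `r ∤ 16(r⁸+1)⁸ ≡ 16 (mod r)`
    intro h
    have h0 := (ZMod.intCast_zmod_eq_zero_iff_dvd _ r).2 h
    push_cast at h0
    rw [hrr] at h0
    simp only [zero_add, one_pow, mul_one] at h0
    exact sixteen_ne_zero r hr hr2 h0

end P6

/-! ## §3. Every genuine Θ-volume datum over a rational point with a deep pole prime `p > 30·l` is OUTSIDE Σ₈ -/

section Out

/-- **OUT OF Σ₈ AT A RATIONAL POINT WITH A DEEP, LARGE POLE PRIME.** `λ ∈ ℚ`, `T` a genuine Θ-volume datum at `(ratPoint λ, l)` (`l` prime),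
`p ∉ {2, 3, 5, l}` a prime with **`30·l < p`** at which `j(λ)` has a pole of exact order `h ≥ 1` with **`8·l + 2 ≤ (l − 3)·h`** ⟹ `¬ InSigma8 T.D`.
At the bad place `x₀ ∣ p` of `GenuineK.exists_bad_tame_place_of_ord_neg` (abc-iut-c312-7): `ord_v(q_v) = h·e(v|p)` ([IUTchI] Def. 3.1 (b),
`ThetaData.neg_ord_j_eq_ramificationIdx_mul_qParamOrd_of_under_mem_VFbad` + `Cor22.ord_algebraMap_eq`), `e_{x₀} ∣ 30·l < p`
(abc-iut-W-neg-1's `ramificationIdx_int_dvd_thirty_mul_ratPoint'`, so `⌊log_p e⌋ = 0`), whence the heavy inequality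
`4·l·e(v|p)·2 + 2 ≤ (l−3)·h·e(v|p)` of `not_inSigma8_of_heavy_of_ramIdx_le` (p479646). [cite: Mochizuki2012, IUTchI Def. 3.1 (b)(c) pp. 61–62;
IUTchIV Prop. 1.2 (i)(ii) p. 10, Thm. 1.10 Steps (ii)–(iii) pp. 24–26] [cite: SerreLocalFields1979, Ch. IV §2 Cor. 1 of Prop. 7]
[claim: Mochizuki2012, status: disputed] -/
theorem not_inSigma8_ratPoint_of_pole {q : ℚ} {l : ℕ} (T : ThetaVolumeDatumAt (ratPoint q) l) (hP : ratPoint q ∈ UP) (hl : l.Prime)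
    (pp : Nat.Primes) (hp2 : (pp : ℕ) ≠ 2) (hp3 : (pp : ℕ) ≠ 3) (hp5 : (pp : ℕ) ≠ 5) (hpl : (pp : ℕ) ≠ l) (h30 : 30 * l < (pp : ℕ))
    {h : ℕ} (hh : 0 < h) (hord : ∀ u : HeightOneSpectrum (𝓞 ℚ), natGenerator u = (pp : ℕ) → ord ℚ u (jInv q) = -(h : ℤ))
    (hineq : 8 * l + 2 ≤ (l - 3) * h) :
    letI := T.instFieldF; letI := T.instNumberFieldF; letI := T.instAlgebraF; letI := T.instFieldK
    letI := T.instNumberFieldK; letI := T.instAlgebraK; letI := T.instFieldFbar; letI := T.instAlgebraFbar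
    letI := T.instAlgebraKFbar; letI := T.instIsElliptic
    ¬ RH.InSigmaDatum.InSigma8 T.D := by
  letI := T.instFieldF; letI := T.instNumberFieldF; letI := T.instAlgebraF; letI := T.instFieldK
  letI := T.instNumberFieldK; letI := T.instAlgebraK; letI := T.instFieldFbar; letI := T.instAlgebraFbar
  letI := T.instAlgebraKFbar; letI := T.instIsElliptic
  haveI : Fact (pp : ℕ).Prime := ⟨pp.2⟩
  -- the place `v₀` of `ℚ` over `p`: pole of order `h`, `e(v₀|p) = 1`
  set v₀ : HeightOneSpectrum (𝓞 ℚ) := (primesEquiv (R := 𝓞 ℚ)).symm ⟨pp.1, pp.2⟩ with hv₀def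
  have hgen : natGenerator v₀ = (pp : ℕ) := natGenerator_primesEquiv_symm pp.1 pp.2
  have hv₀ : ((pp : ℕ) : 𝓞 ℚ) ∈ v₀.asIdeal := FreyP6Engine.natCast_mem_asIdeal pp.1 pp.2
  have hram₀ : ramIdx ℚ v₀ = 1 := by
    rw [ramIdx_eq]; exact Literature.NumberTheory.EllipticCurves.Fisher2016.ramificationIdx_int_rat_eq_one v₀
  have hv₀e : ¬ (pp : ℕ) ∣ ramIdx ℚ v₀ := by rw [hram₀]; exact pp.2.not_dvd_one
  have hm : ord ℚ v₀ (jInv q) = -(h : ℤ) := hord v₀ hgen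
  -- a BAD place `x₀ ∣ p` of the `K`-level pilot datum
  obtain ⟨x₀, hx₀S, -, -, -⟩ := GenuineK.exists_bad_tame_place_of_ord_neg T hP hl pp hp2 hp3 hp5 hpl v₀ hv₀ hv₀e hm hh
  set w := placeOf (pilotDataOfK T.D T.K) pp.1 x₀ with hwdef
  set v := finBelow T.F T.K w with hvdef
  set u₀ := finBelow (ratPoint q).F T.F v with hu₀def
  have hw_under : w.under (𝓞 T.F) = v := rfl
  have hv_under : v.under (𝓞 (ratPoint q).F) = u₀ := rfl
  -- the same place read in `HeightOneSpectrum (𝓞 ℚ)` verbatim (the prime under it is `p`)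
  obtain ⟨u₁, hu₁⟩ : ∃ u₁ : HeightOneSpectrum (𝓞 ℚ), u₁ = finBelow (ratPoint q).F T.F v := ⟨_, rfl⟩
  have hu₁gen : natGenerator u₁ = (pp : ℕ) :=
    GenuineK.natGenerator_eq_of_eq_finBelow_placeOf T pp x₀ u₁ (by rw [hu₁, hvdef, hwdef])
  have hordu₀ : Literature.IUT.LogVolume.ord (ratPoint q).F (finBelow (ratPoint q).F T.F v) (jInv (ratPoint q).x) = -(h : ℤ) := by
    have := hord u₁ hu₁gen
    rw [hu₁] at this
    exact this
  -- `v ∈ 𝕍(F)^bad`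
  have hvVFbad : FinitePlace.mk v ∈ T.D.VFbad := (mem_pilotDataOfK_S_iff T.D T.K w).mp hx₀S
  -- `ord_v(q_v) = h·e(v|u₀)`
  have hq : (qParamOrd T.E v : ℤ) = (Ideal.ramificationIdx' u₀.asIdeal v.asIdeal : ℤ) * h := by
    have h1 := ThetaData.neg_ord_j_eq_ramificationIdx_mul_qParamOrd_of_under_mem_VFbad T.D (w := w)
      (by rw [hw_under]; exact hvVFbad)
    rw [hw_under] at h1
    have h2 : Literature.IUT.LogVolume.ord T.K w (algebraMap T.F T.K T.E.j) =
        (Ideal.ramificationIdx' v.asIdeal w.asIdeal : ℤ) * ((Ideal.ramificationIdx' u₀.asIdeal v.asIdeal : ℤ) * (-(h : ℤ))) := by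
      rw [Cor22.ord_algebraMap_eq w, T.j_eq, Cor22.ord_algebraMap_eq v, hordu₀]
    rw [h2] at h1
    have hne : (Ideal.ramificationIdx' v.asIdeal w.asIdeal : ℤ) ≠ 0 := by
      exact_mod_cast Ideal.IsDedekindDomain.ramificationIdx'_ne_zero_of_liesOver w.asIdeal v.ne_bot
    have h3 : (Ideal.ramificationIdx' v.asIdeal w.asIdeal : ℤ) * (qParamOrd T.E v : ℤ) =
        (Ideal.ramificationIdx' v.asIdeal w.asIdeal : ℤ) * ((Ideal.ramificationIdx' u₀.asIdeal v.asIdeal : ℤ) * h) := by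
      linarith
    exact mul_left_cancel₀ hne h3
  have hq' : qParamOrd T.E v = Ideal.ramificationIdx' u₀.asIdeal v.asIdeal * h := by exact_mod_cast hq
  -- `e(v|p) = e(u₀|p)·e(v|u₀) = e(v|u₀)`
  have hramu₀ : ramIdx (ratPoint q).F u₀ = 1 := by
    rw [ramIdx_eq]; exact Literature.NumberTheory.EllipticCurves.Fisher2016.ramificationIdx_int_rat_eq_one u₀
  have hramv : ramIdx T.F v = Ideal.ramificationIdx' u₀.asIdeal v.asIdeal := by
    rw [ramIdx_eq, ThetaData.absRamificationIdx_eq_ramIdx_mul (F := (ratPoint q).F) v, hv_under, hramu₀, one_mul]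
  -- `e_w ∣ 30·l < p`, so `⌊log_p(30·l)⌋ = 0`
  have hpole : ∀ u : HeightOneSpectrum (𝓞 ℚ), natGenerator u = (pp : ℕ) → ord ℚ u (jInv q) < 0 := by
    intro u hu; rw [hord u hu]
    have : (0 : ℤ) < h := by exact_mod_cast hh
    linarith
  have hnot : (pp : ℕ) ∉ ({2, 3, 5, l} : Finset ℕ) := by
    simp only [Finset.mem_insert, Finset.mem_singleton, not_or]
    exact ⟨hp2, hp3, hp5, hpl⟩
  have hwchar : residueChar T.K w = (pp : ℕ) := residueChar_eq_of_natCast_mem pp.1 (natCast_mem_placeOf (pilotDataOfK T.D T.K) pp.1 x₀)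
  have hB : ramIdx T.K w ≤ 30 * l := by
    rw [ramIdx_eq]
    exact Nat.le_of_dvd (by have := hl.two_le; omega) (T.ramificationIdx_int_dvd_thirty_mul_ratPoint' hnot hpole w hwchar)
  have hlog : Nat.log (pp : ℕ) (30 * l) = 0 := Nat.log_eq_zero_iff.2 (Or.inl h30)
  have he1 : 1 ≤ Ideal.ramificationIdx' u₀.asIdeal v.asIdeal :=
    Nat.one_le_iff_ne_zero.2 (Ideal.IsDedekindDomain.ramificationIdx'_ne_zero_of_liesOver v.asIdeal u₀.ne_bot)
  -- the heavy inequality `4·l·e·2 + 2 ≤ (l−3)·(e·h)`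
  refine not_inSigma8_of_heavy_of_ramIdx_le T.D pp x₀ hx₀S (30 * l) hB ?_
  change 4 * l * ramIdx T.F v * (Nat.log (pp : ℕ) (30 * l) + 2) + 2 ≤ (l - 3) * qParamOrd T.E v
  rw [hlog, hramv, hq']
  set e := Ideal.ramificationIdx' u₀.asIdeal v.asIdeal with hedef
  calc 4 * l * e * (0 + 2) + 2 = 8 * l * e + 2 := by ring
    _ ≤ (8 * l + 2) * e := by nlinarith [he1]
    _ ≤ ((l - 3) * h) * e := Nat.mul_le_mul_right _ hineq
    _ = (l - 3) * (e * h) := by ring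

/-- **Every genuine Θ-volume datum over `(ratPoint λ_r, l)` is OUTSIDE Σ₈** for primes `l ≥ 7` and `r > 30·l` (part 1: pole of order `16` at `r`;
`8l + 2 ≤ 16(l−3)` for `l ≥ 7`). [cite: Mochizuki2012, IUTchI Def. 3.1 (b)(c) pp. 61–62; IUTchIV Prop. 1.2 (i)(ii) p. 10] [claim: Mochizuki2012, status: disputed] -/
theorem not_inSigma8_of_datum {r l : ℕ} (T : ThetaVolumeDatumAt (ratPoint (((r ^ 8 : ℕ) : ℚ) / ((r ^ 8 + 1 : ℕ) : ℚ))) l)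
    (hl : l.Prime) (hl7 : 7 ≤ l) (hr : r.Prime) (h30 : 30 * l < r) :
    letI := T.instFieldF; letI := T.instNumberFieldF; letI := T.instAlgebraF; letI := T.instFieldK
    letI := T.instNumberFieldK; letI := T.instAlgebraK; letI := T.instFieldFbar; letI := T.instAlgebraFbar
    letI := T.instAlgebraKFbar; letI := T.instIsElliptic
    ¬ RH.InSigmaDatum.InSigma8 T.D :=
  not_inSigma8_ratPoint_of_pole T (mem_UP r hr.pos) hl ⟨r, hr⟩ (by change r ≠ 2; omega) (by change r ≠ 3; omega)
    (by change r ≠ 5; omega) (by change r ≠ l; omega) h30 (h := 16) (by norm_num)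
    (fun u hu => by rw [ord_jInv_of_natGenerator_eq r hr (by omega) u hu]; norm_num) (by omega)

end Out

/-! ## §4. «NOT UNIFORMLY»: no `l₀` serves all genuine data -/

/-- **Q3 (row 8), UNIFORM READING — REFUTED UNCONDITIONALLY.** There is NO `l₀` such that every [IUTchI] Def. 3.1 datum `D` of every level
`l ≥ l₀`, over every curve `(F, E_F)` with every `K`, `F̄`, `Pb`, lies in Σ₈ (`RH.InSigmaDatum.InSigma8 D`). Witness at a given `l₀`: a prime
`l ≡ 3 (mod 4)`, `l > max(l₀, 160)` (Dirichlet), a prime `r ∈ (30l, 60l]` (Bertrand), the point `λ_r = r⁸/(r⁸+1)` — admissible with (P2), (P5) (part 1)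
and (P6) (§2 here) — a genuine Θ-volume datum over `(ratPoint λ_r, l)` by `ThetaPartII.stub_thetaData` ([IUTchIV] Cor. 2.2 (ii) proof (P7)), which is
outside Σ₈ by §3. Compare `lTailSigma8_holds` (p479487): every FIXED curve is inside Σ₈ for `l ≥ l₀(E)` — so `l₀(E)` is unbounded over curves
(«YES PER DATUM, NOT UNIFORMLY», both halves now theorems). The Galois-guarded form `UniformLTailSigma8` (p481222) is implied by the
statement refuted here only in the converse direction; its refutation stays modulo `HeavyGaloisData` (`IsGalois ℚ K` of the witness tower
not derived). No abc claim; no side taken on [IUTchIII] Cor. 3.12; `InSigma8` = row 8's hypothesis vocabulary; refuted-as-typed ≠ refuted-in-print.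
[cite: Mochizuki2012, IUTchI Def. 3.1 (b)(c) pp. 61–62, Ex. 3.2 (iv) p. 71; IUTchIV Prop. 1.2 (i)(ii) p. 10, Cor. 2.2 (ii) proof (P2)(P5)(P6)(P7)
pp. 45–46] [cite: Mazur1978, §6 Prop. 6.3 (1) p. 153] [claim: Mochizuki2012, status: disputed] -/
theorem not_exists_uniform_l0_inSigma8 :
    ¬ ∃ l₀ : ℕ, ∀ l : ℕ, l₀ ≤ l →
      ∀ (F : Type) [Field F] [NumberField F] (E : WeierstrassCurve F) [E.IsElliptic]
        (K Fbar : Type) [Field K] [NumberField K] [Algebra F K] [Field Fbar] [Algebra F Fbar] [Algebra K Fbar]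
        (Pb : BadPlacePredicates K) (D : InitialThetaData F K Fbar E l Pb), RH.InSigmaDatum.InSigma8 D := by
  rintro ⟨l₀, h⟩
  -- a prime `l ≡ 3 (mod 4)` beyond `max l₀ 160`
  obtain ⟨l, hlgt, hl, hmod⟩ := Nat.forall_exists_prime_gt_and_modEq (max l₀ 160) (q := 4) (a := 3) (by norm_num) (by norm_num)
  have hl0 : l₀ ≤ l := le_trans (le_max_left _ _) hlgt.le
  have hl160 : 160 ≤ l := le_trans (le_max_right _ _) hlgt.le
  have hmod' : l % 4 = 3 := hmod
  -- a prime `r` with `30·l < r ≤ 60·l`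
  obtain ⟨r, hr, h30, h60⟩ := Nat.exists_prime_lt_and_le_two_mul (30 * l) (by omega)
  have hr2 : r ≠ 2 := by omega
  have hr5 : r ≠ 5 := by omega
  have hrl : r ≠ l := by omega
  have h3l : r ^ 8 + 1 < 3 ^ l := pow_eight_succ_lt_three_pow hl160 (by omega)
  -- a genuine Θ-volume datum at `(ratPoint λ_r, l)`
  obtain ⟨T⟩ := ThetaPartII.stub_thetaData (ratPoint (((r ^ 8 : ℕ) : ℚ) / ((r ^ 8 + 1 : ℕ) : ℚ))) (mem_UP r hr.pos) l hl (by omega)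
    (admitsCore r hr (by omega)) (condP2 r hr hr2 hl (by omega) h3l) (condP5 r hr hr2 hl hrl) (condP6 r hr hr2 hr5 hl (by omega) hmod' hrl)
  letI := T.instFieldF; letI := T.instNumberFieldF; letI := T.instAlgebraF; letI := T.instFieldK
  letI := T.instNumberFieldK; letI := T.instAlgebraK; letI := T.instFieldFbar; letI := T.instAlgebraFbar
  letI := T.instAlgebraKFbar; letI := T.instIsElliptic
  exact not_inSigma8_of_datum T hl (by omega) hr h30 (h l hl0 T.F T.E T.K T.Fbar T.Pb T.D)

/-- **Bookkeeping against the guarded reading**: the statement refuted above implies `UniformLTailSigma8` (p481222; data with `K/ℚ` Galois only) —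
recorded so that the two uniform readings are not confused: `¬ UniformLTailSigma8` is the STRONGER negation and is NOT claimed here. [folklore] -/
theorem uniformLTailSigma8_of_forall
    (h : ∃ l₀ : ℕ, ∀ l : ℕ, l₀ ≤ l →
      ∀ (F : Type) [Field F] [NumberField F] (E : WeierstrassCurve F) [E.IsElliptic]
        (K Fbar : Type) [Field K] [NumberField K] [Algebra F K] [Field Fbar] [Algebra F Fbar] [Algebra K Fbar]
        (Pb : BadPlacePredicates K) (D : InitialThetaData F K Fbar E l Pb), RH.InSigmaDatum.InSigma8 D) :
    UniformLTailSigma8 := by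
  obtain ⟨l₀, h⟩ := h
  exact ⟨l₀, fun l hl F _ _ E _ K Fbar _ _ _ _ _ _ Pb D _ => h l hl F E K Fbar Pb D⟩

end UniformWitness

end Summit.ABC.IUTFork.Repair.RH.Q3LTailSigma8

end
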